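import Literature.MathematicalPhysics.QuantumLattice.SectorisedIncrementBoundDBPlateau
import Literature.MathematicalPhysics.QuantumLattice.GrassmannEffectiveActionGradedTruncationDB
import HarnessLib

/-!
# The orders `≥ 2` of the sectorised single-scale INCREMENT `effAction C G − e^{Δ_C} G` in GRADED form, plateau transport:
# product form with the leg constraint for the orders `2 ≤ n < N₀`, geometric tail beyond

Topic `MathematicalPhysics/QuantumLattice`; sequel of `SectorisedIncrementBoundDBPlateau` (whose §1/§2 bound the orders `≥ 2` of the increment
FLATLY: `≤ cr cc^m ε^m ρ^{-(m+1)} e‖Ṽ‖_h θ/(1−θ)` — first order in `‖Ṽ‖_h` in every output degree, which forgets that the degree-`2p` kernel of an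
order-`n` cumulant of kernels of half-degrees `δ_a` vanishes unless `2p + 2(n−1) ≤ Σ_a 2δ_a`, i.e. forgets the perturbative order `λ^{p−1}`) and of
`GrassmannEffectiveActionGradedTruncationDB` (the GRADED abstract step `sum_norm_kernel_effAction_sub_gaussConv_le_graded_of_gramBounded`: orders
`2 ≤ n < N₀` in product form WITH the leg constraint, orders `≥ N₀` as the flat tail `θ^{N₀−1}`).  Here the graded abstract step is read through a
substitution `f` (sector fields, pulled-back covariance `C′ = fᵀ C f`) and an analysis map `g` (Young costs `cr·cc^m`), and then transported to the
Hubbard torus by the plateau machinery of the flat files, VERBATIM (Benfatto–Giuliani–Mastropietro 2006 (2.61)–(2.63), (2.66), (2.77)–(2.83); the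
one-level bound a BLOCKED birth-level iteration of single-scale steps consumes — cell gate-hubbard-kl, K3 engine child, clause (E1), the hypothesis
`(Hstep)` of the dimensionless tower `towerBorn_le_law₄` in MODEL currency, orders `≥ 2`):

* §1 (generic label sets) **`kernelNorm_kernel_map_effAction_sub_gaussConv_le_graded_of_gramBounded`** —
  `‖kernel_{m+1} (map g (effAction C V − e^{Δ_C}V))‖_ε ≤ cr·cc^m·ε^m·[ Σ_{n=2}^{N₀−1} ρ^{-(m+1)} κ^{-2(n−1)} α^{n−1} eⁿ · S_n(m+1) + ρ^{-(m+1)} e‖Ṽ‖_h θ^{N₀−1}/(1−θ) ]`,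
  `S_n(r) = Σ_{δ ∈ [0,|Γ′|/2]^n, r + 2(n−1) ≤ Σ 2δ_a} Π_a (e²(κ+ρ))^{2δ_a} N(δ_a)`, `N(m′) = ‖kernel_{2m′} Ṽ‖_1`, `V = map f Ṽ`;
* §2 (Hubbard torus, plateau transfer; a private monotonicity helper for the graded right side)
  **`hubbardSectorKernelNorm_effAction_sub_gaussConv_le_graded_of_gramBounded_of_plateau`** — the orders `≥ 2` of the increment of the sectorised kernels
  of `G` across one (single- or multi-slice) covariance `C`, output family `F′`, every degree `m+1`, every constraint set `A`, in GRADED form with the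
  profile `N̄(m′) = ε_x‖G‖_{F,univ,2m′}` of the INPUT family `F` (thin/fat pair `F, F̃`, plateau of `F` over `supp C` and over `F′`).

Everything is proved; no definition, no named fact.  NOT here: the first order (binomial–Gram, already `…_gaussConv_sub_le_binomial_…_of_plateau`), the
prescribed-leg (levels) and weighted twins (the abstract suppliers `…GradedTruncationPrescribedDB`, `GrassmannWeighted…` exist; their plateau transport is
the same text with the prescribed/weighted pinned sums), and every model constant.

## Sources

G. Benfatto, A. Giuliani, V. Mastropietro, Ann. Henri Poincaré 7 (2006) 809–898, (2.13)–(2.14), (2.61)–(2.63), (2.66), (2.70)–(2.71a), (2.76)–(2.83)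
[`BenfattoGiulianiMastropietro2006`]; W. de Siqueira Pedra, M. Salmhofer, Comm. Math. Phys. 282 (2008) 797–818, Thm 1.3 [`PedraSalmhofer2008`];
K. Gawȩdzki, A. Kupiainen, Comm. Math. Phys. 102 (1985) 1–30, §3 [`GawedzkiKupiainen1985GrossNeveu`].
-/

noncomputable section

namespace Literature.MathematicalPhysics.QuantumLattice

open GrassmannAlgebra Finset Literature.Probability.LatticeModels
open scoped Nat

universe u

/-! ### §1 Generic label sets: the graded orders `≥ 2` of the increment read through `(f, g)` -/

section Generic

variable {𝕜 : Type*} [RCLike 𝕜] {Γ Γ' Γ'' : Type u} [Fintype Γ] [DecidableEq Γ] [Fintype Γ'] [DecidableEq Γ']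
  [Fintype Γ''] [DecidableEq Γ'']

/-- **Orders `≥ 2` of the increment, read through `(f, g)`, GRADED** (BGM 2006 (2.61)–(2.63), (2.66), (2.77)–(2.83); Gawȩdzki–Kupiainen 1985, §3):
`Ṽ` even without constant part, `C′ = fᵀ C f` replica-Gram-bounded (`κ > 0`) with row/column sums `≤ α`, `θ = eα‖Ṽ‖_h/κ² < 1`, analysis costs `(cr, cc)`
of `g ∘ f`, truncation order `N₀ ≥ 2`; then in every degree `m + 1`,
`‖kernel_{m+1} (map g (effAction C (map f Ṽ) − e^{Δ_C}(map f Ṽ)))‖_ε ≤ cr·cc^m·ε^m·[Σ_{n=2}^{N₀−1} ρ^{-(m+1)} κ^{-2(n−1)} α^{n−1} eⁿ S_n(m+1) + ρ^{-(m+1)} e‖Ṽ‖_h θ^{N₀−1}/(1−θ)]`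
with `S_n(r) = Σ_{δ, r + 2(n−1) ≤ Σ 2δ_a} Π_a (e²(κ+ρ))^{2δ_a} ‖kernel_{2δ_a} Ṽ‖_1` — the leg constraint kept order by order.
[cite: BenfattoGiulianiMastropietro2006, (2.61)-(2.63), (2.66), (2.83)] -/
theorem kernelNorm_kernel_map_effAction_sub_gaussConv_le_graded_of_gramBounded
    (C : Matrix Γ Γ 𝕜) (f : (Γ' → 𝕜) →ₗ[𝕜] (Γ → 𝕜)) (g : (Γ → 𝕜) →ₗ[𝕜] (Γ'' → 𝕜))
    (Vt : GrassmannAlgebra 𝕜 Γ') (hVt : Vt ∈ evenPart 𝕜 Γ') (hVt0 : constPart 𝕜 Vt = 0)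
    {κ : ℝ} (hκ : 0 < κ) (hGB : IsGramBoundedR ((LinearMap.toMatrix' f).transpose * C * LinearMap.toMatrix' f) κ)
    {α : ℝ} (hα : 0 < α)
    (hrow : ∀ X, ∑ Y, ‖((LinearMap.toMatrix' f).transpose * C * LinearMap.toMatrix' f) X Y‖ ≤ α)
    (hcol : ∀ Y, ∑ X, ‖((LinearMap.toMatrix' f).transpose * C * LinearMap.toMatrix' f) X Y‖ ≤ α)
    {ρ : ℝ} (hρ : 0 < ρ)
    (hθ : Real.exp 1 * α * normV Γ' κ ρ (fun m' => kernelNorm 1 (2 * m') (kernel 𝕜 Vt (2 * m'))) / κ ^ 2 < 1)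
    {cr cc : ℝ} (hcr0 : 0 ≤ cr) (hcc0 : 0 ≤ cc)
    (hrow' : ∀ X'', ∑ X', ‖(LinearMap.toMatrix' g * LinearMap.toMatrix' f) X'' X'‖ ≤ cr)
    (hcol' : ∀ X', ∑ X'', ‖(LinearMap.toMatrix' g * LinearMap.toMatrix' f) X'' X'‖ ≤ cc)
    {ε : ℝ} (hε : 0 ≤ ε) {N₀ : ℕ} (hN₀ : 2 ≤ N₀) (m : ℕ) :
    kernelNorm ε (m + 1) (kernel 𝕜 (ExteriorAlgebra.map g
        (effAction 𝕜 C (ExteriorAlgebra.map f Vt) - gaussConv 𝕜 C (ExteriorAlgebra.map f Vt))) (m + 1)) ≤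
      cr * cc ^ m * ε ^ m *
        (∑ n ∈ Ico 2 N₀, (ρ⁻¹ ^ (m + 1) * κ⁻¹ ^ (2 * (n - 1)) * (α ^ (n - 1) * Real.exp n)) *
            ∑ δ ∈ (Fintype.piFinset fun _ : Fin n => range (Fintype.card Γ' / 2 + 1)) with m + 1 + 2 * (n - 1) ≤ ∑ a, 2 * δ a,
              ∏ a, (Real.exp 2 * (κ + ρ)) ^ (2 * δ a) * kernelNorm 1 (2 * δ a) (kernel 𝕜 Vt (2 * δ a)) +
          ρ⁻¹ ^ (m + 1) * (Real.exp 1 * normV Γ' κ ρ (fun m' => kernelNorm 1 (2 * m') (kernel 𝕜 Vt (2 * m')))) *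
            (Real.exp 1 * α * normV Γ' κ ρ (fun m' => kernelNorm 1 (2 * m') (kernel 𝕜 Vt (2 * m'))) / κ ^ 2) ^ (N₀ - 1) /
            (1 - Real.exp 1 * α * normV Γ' κ ρ (fun m' => kernelNorm 1 (2 * m') (kernel 𝕜 Vt (2 * m'))) / κ ^ 2)) := by
  set C' : Matrix Γ' Γ' 𝕜 := (LinearMap.toMatrix' f).transpose * C * LinearMap.toMatrix' f with hC'
  set N : ℕ → ℝ := fun m' => kernelNorm 1 (2 * m') (kernel 𝕜 Vt (2 * m')) with hN
  set nV : ℝ := normV Γ' κ ρ N with hnV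
  -- the graded abstract bound in the auxiliary representation
  have hN0 : ∀ m', 0 ≤ N m' := fun m' => kernelNorm_nonneg zero_le_one _ _
  have hgraded := sum_norm_kernel_effAction_sub_gaussConv_le_graded_of_gramBounded C' hκ hGB Vt hVt hVt0 N hN0
    (fun m' j w => pinnedSum_le_kernelNorm_one _ j w) hα hrow hcol hρ hθ hN₀ (Nat.succ_pos m)
  have hnV0 : 0 ≤ nV := normV_nonneg hκ.le hρ.le hN0
  have hθ0 : 0 ≤ Real.exp 1 * α * nV / κ ^ 2 := by positivity
  set B : ℝ := ∑ n ∈ Ico 2 N₀, (ρ⁻¹ ^ (m + 1) * κ⁻¹ ^ (2 * (n - 1)) * (α ^ (n - 1) * Real.exp n)) *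
      ∑ δ ∈ (Fintype.piFinset fun _ : Fin n => range (Fintype.card Γ' / 2 + 1)) with m + 1 + 2 * (n - 1) ≤ ∑ a, 2 * δ a,
        ∏ a, (Real.exp 2 * (κ + ρ)) ^ (2 * δ a) * N (δ a) +
    ρ⁻¹ ^ (m + 1) * (Real.exp 1 * nV) * (Real.exp 1 * α * nV / κ ^ 2) ^ (N₀ - 1) / (1 - Real.exp 1 * α * nV / κ ^ 2) with hB
  have hB0 : 0 ≤ B := by
    refine add_nonneg (sum_nonneg fun n _ => mul_nonneg (by positivity) (sum_nonneg fun δ _ => prod_nonneg fun a _ => ?_))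
      (div_nonneg (by positivity) (by linarith))
    exact mul_nonneg (by positivity) (hN0 _)
  have haux : kernelNorm 1 (m + 1) (kernel 𝕜 (effAction 𝕜 C' Vt - gaussConv 𝕜 C' Vt) (m + 1)) ≤ B :=
    kernelNorm_succ_le_of_forall 1 m _ hB0 fun i w => by
      rw [one_pow, one_mul]
      exact hgraded i w
  -- read through `g ∘ f`
  have hsub : effAction 𝕜 C (ExteriorAlgebra.map f Vt) - gaussConv 𝕜 C (ExteriorAlgebra.map f Vt) =
      ExteriorAlgebra.map f (effAction 𝕜 C' Vt - gaussConv 𝕜 C' Vt) := by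
    rw [effAction_map, gaussConv_map, map_sub]
  rw [hsub, map_map_eq_map_comp, kernelNorm_eq_pow_mul_kernelNorm_one hε]
  have hY := kernelNorm_kernel_map_le (g ∘ₗ f) hcr0 hcc0 (ε := 1)
    (by intro X''; rw [LinearMap.toMatrix'_comp]; exact hrow' X'')
    (by intro X'; simp only [LinearMap.toMatrix'_comp]; exact hcol' X') zero_le_one (effAction 𝕜 C' Vt - gaussConv 𝕜 C' Vt) m
  calc ε ^ m * kernelNorm 1 (m + 1) (kernel 𝕜 (ExteriorAlgebra.map (g ∘ₗ f) (effAction 𝕜 C' Vt - gaussConv 𝕜 C' Vt)) (m + 1))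
      ≤ ε ^ m * (cr * cc ^ m * kernelNorm 1 (m + 1) (kernel 𝕜 (effAction 𝕜 C' Vt - gaussConv 𝕜 C' Vt) (m + 1))) :=
        mul_le_mul_of_nonneg_left hY (pow_nonneg hε _)
    _ ≤ ε ^ m * (cr * cc ^ m * B) := mul_le_mul_of_nonneg_left (mul_le_mul_of_nonneg_left haux (by positivity)) (pow_nonneg hε _)
    _ = cr * cc ^ m * ε ^ m * B := by ring

end Generic

/-! ### §2 The Hubbard torus: monotonicity of the graded right side and the plateau transfer -/

section Transfer

open scoped InnerProductSpace

/-- **The graded right side is monotone in the profile**: for `0 ≤ N₁ ≤ N₂` pointwise (any label type, `κ, α, ρ ≥ 0`, `θ(N₂) < 1`),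
`Σ_n c_n S_n(r; N₁) + ρ^{-r} e‖N₁‖_h θ(N₁)^{N₀−1}/(1−θ(N₁)) ≤` the same with `N₂` (private helper of the plateau transfer). [folklore] -/
private theorem gradedIncrementBound_mono (Γ : Type u) [Fintype Γ] {κ α ρ : ℝ} (hκ : 0 < κ) (hα : 0 ≤ α) (hρ : 0 ≤ ρ) {N₁ N₂ : ℕ → ℝ}
    (h0 : ∀ m', 0 ≤ N₁ m') (hle : ∀ m', N₁ m' ≤ N₂ m') (hθ : Real.exp 1 * α * normV Γ κ ρ N₂ / κ ^ 2 < 1) (N₀ r : ℕ) :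
    ∑ n ∈ Ico 2 N₀, (ρ⁻¹ ^ r * κ⁻¹ ^ (2 * (n - 1)) * (α ^ (n - 1) * Real.exp n)) *
        ∑ δ ∈ (Fintype.piFinset fun _ : Fin n => range (Fintype.card Γ / 2 + 1)) with r + 2 * (n - 1) ≤ ∑ a, 2 * δ a,
          ∏ a, (Real.exp 2 * (κ + ρ)) ^ (2 * δ a) * N₁ (δ a) +
      ρ⁻¹ ^ r * (Real.exp 1 * normV Γ κ ρ N₁) * (Real.exp 1 * α * normV Γ κ ρ N₁ / κ ^ 2) ^ (N₀ - 1) /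
        (1 - Real.exp 1 * α * normV Γ κ ρ N₁ / κ ^ 2) ≤
    ∑ n ∈ Ico 2 N₀, (ρ⁻¹ ^ r * κ⁻¹ ^ (2 * (n - 1)) * (α ^ (n - 1) * Real.exp n)) *
        ∑ δ ∈ (Fintype.piFinset fun _ : Fin n => range (Fintype.card Γ / 2 + 1)) with r + 2 * (n - 1) ≤ ∑ a, 2 * δ a,
          ∏ a, (Real.exp 2 * (κ + ρ)) ^ (2 * δ a) * N₂ (δ a) +
      ρ⁻¹ ^ r * (Real.exp 1 * normV Γ κ ρ N₂) * (Real.exp 1 * α * normV Γ κ ρ N₂ / κ ^ 2) ^ (N₀ - 1) /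
        (1 - Real.exp 1 * α * normV Γ κ ρ N₂ / κ ^ 2) := by
  have hV1 : 0 ≤ normV Γ κ ρ N₁ := normV_nonneg hκ.le hρ h0
  have hV12 : normV Γ κ ρ N₁ ≤ normV Γ κ ρ N₂ := normV_mono hκ.le hρ hle
  have hV2 : 0 ≤ normV Γ κ ρ N₂ := hV1.trans hV12
  have hθ1 : 0 ≤ Real.exp 1 * α * normV Γ κ ρ N₁ / κ ^ 2 := by positivity
  have hθ12 : Real.exp 1 * α * normV Γ κ ρ N₁ / κ ^ 2 ≤ Real.exp 1 * α * normV Γ κ ρ N₂ / κ ^ 2 := by gcongr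
  refine add_le_add (sum_le_sum fun n _ => mul_le_mul_of_nonneg_left (sum_le_sum fun δ _ => ?_) (by positivity)) ?_
  · exact prod_le_prod (fun a _ => mul_nonneg (by positivity) (h0 _)) fun a _ => mul_le_mul_of_nonneg_left (hle _) (by positivity)
  · have hpos : 0 < 1 - Real.exp 1 * α * normV Γ κ ρ N₂ / κ ^ 2 := by linarith
    have hnum : ρ⁻¹ ^ r * (Real.exp 1 * normV Γ κ ρ N₁) * (Real.exp 1 * α * normV Γ κ ρ N₁ / κ ^ 2) ^ (N₀ - 1) ≤
        ρ⁻¹ ^ r * (Real.exp 1 * normV Γ κ ρ N₂) * (Real.exp 1 * α * normV Γ κ ρ N₂ / κ ^ 2) ^ (N₀ - 1) := by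
      gcongr
    exact div_le_div₀ (by positivity) hnum hpos (by linarith)

variable {L M : ℕ} [NeZero L] [NeZero M] {N N' : ℕ}

/-- **The orders `≥ 2` of the increment of the sectorised kernels across one slice, GRADED** (BGM 2006 (2.61)–(2.63), (2.66), (2.77)–(2.83)): data as in
`hubbardSectorKernelNorm_effAction_sub_gaussConv_le_of_gramBounded_of_plateau` (even input `G` without constant part, thin/fat families `F, F̃`
(`F̃F = F`, `ΣF = 0 ⇒ F = 0`), plateau of `F` over the covariance `C` and over the output family `F′`, sectorised covariance `S(F̃)ᵀ C S(F̃)` replica-Gram-bounded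
with `κ > 0` and row/column sums `≤ α`, radius `ρ`, `θ̄ = eα‖G‖_h/κ² < 1` with `‖G‖_h = normV Γ′ κ ρ N̄`, `N̄(m′) = ε_x‖G‖_{F,univ,2m′}`, overlap costs
`(cr, cc)`), truncation order `N₀ ≥ 2`; then in every degree `m + 1` and for every constraint set `A`,
`‖effAction C G − e^{Δ_C} G‖_{F′, A, m+1} ≤ cr cc^m ε_x^m [ Σ_{n=2}^{N₀−1} ρ^{-(m+1)} κ^{-2(n−1)} α^{n−1} eⁿ S_n(m+1; N̄) + ρ^{-(m+1)} e‖G‖_h θ̄^{N₀−1}/(1−θ̄) ]`,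
`S_n(r; N̄) = Σ_{δ ∈ [0, |Γ′|/2]^n, r + 2(n−1) ≤ Σ 2δ_a} Π_a (e²(κ+ρ))^{2δ_a} N̄(δ_a)`, `Γ′ = SpaceTimeIdx × SectorLeg N` — the orders `≥ 2` born across the
slice keep the leg constraint, hence the perturbative order of the high-degree output kernels. [cite: BenfattoGiulianiMastropietro2006, (2.61)-(2.63), (2.66), (2.83)] -/
theorem hubbardSectorKernelNorm_effAction_sub_gaussConv_le_graded_of_gramBounded_of_plateau
    {β : ℝ} (hβ : 0 < β) (F Ft : Fin N → FreqMomentum L M → ℂ) (hFF : ∀ ω k, Ft ω k * F ω k = F ω k)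
    (hF0 : ∀ k, ∑ ω, F ω k = 0 → ∀ ω, F ω k = 0)
    (F' : Fin N' → FreqMomentum L M → ℂ) (G : HubbardGrassmann L M) (hG : G ∈ evenPart ℂ (HubbardFieldIdx L M))
    (hG0 : constPart ℂ G = 0)
    (C : Matrix (HubbardFieldIdx L M) (HubbardFieldIdx L M) ℂ)
    (hCpl : ∀ X Y, C X Y ≠ 0 → ∑ ω, F ω X.1.1 = 1 ∧ ∑ ω, F ω Y.1.1 = 1)
    (hF'pl : ∀ (ω' : Fin N') (k : FreqMomentum L M), F' ω' k ≠ 0 → ∑ ω, F ω k = 1)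
    {κ : ℝ} (hκ : 0 < κ)
    (hGB : IsGramBoundedR ((sectorSubMatrix L M β Ft).transpose * C * sectorSubMatrix L M β Ft) κ)
    {α : ℝ} (hα : 0 < α)
    (hrow : ∀ X, ∑ Y, ‖((sectorSubMatrix L M β Ft).transpose * C * sectorSubMatrix L M β Ft) X Y‖ ≤ α)
    (hcol : ∀ Y, ∑ X, ‖((sectorSubMatrix L M β Ft).transpose * C * sectorSubMatrix L M β Ft) X Y‖ ≤ α)
    {ρ : ℝ} (hρ : 0 < ρ)
    (hθ : Real.exp 1 * α * normV (SpaceTimeIdx L M × SectorLeg N) κ ρ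
      (fun m' => imagTimeWeight β M *
        hubbardSectorKernelNorm L M β F (univ : Finset (Fin (2 * m') → SectorLeg N)) G) / κ ^ 2 < 1)
    {cr cc : ℝ} (hcr0 : 0 ≤ cr) (hcc0 : 0 ≤ cc)
    (hrow' : ∀ X'', ∑ X', ‖(sectorAnalysisMatrix L M β F' * sectorSubMatrix L M β Ft) X'' X'‖ ≤ cr)
    (hcol' : ∀ X', ∑ X'', ‖(sectorAnalysisMatrix L M β F' * sectorSubMatrix L M β Ft) X'' X'‖ ≤ cc)
    {N₀ : ℕ} (hN₀ : 2 ≤ N₀) (m : ℕ) (A : Finset (Fin (m + 1) → SectorLeg N')) :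
    hubbardSectorKernelNorm L M β F' A (effAction ℂ C G - gaussConv ℂ C G) ≤
      cr * cc ^ m * imagTimeWeight β M ^ m *
        (∑ n ∈ Ico 2 N₀, (ρ⁻¹ ^ (m + 1) * κ⁻¹ ^ (2 * (n - 1)) * (α ^ (n - 1) * Real.exp n)) *
            ∑ δ ∈ (Fintype.piFinset fun _ : Fin n => range (Fintype.card (SpaceTimeIdx L M × SectorLeg N) / 2 + 1)) with
                m + 1 + 2 * (n - 1) ≤ ∑ a, 2 * δ a,
              ∏ a, (Real.exp 2 * (κ + ρ)) ^ (2 * δ a) *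
                (imagTimeWeight β M * hubbardSectorKernelNorm L M β F (univ : Finset (Fin (2 * δ a) → SectorLeg N)) G) +
          ρ⁻¹ ^ (m + 1) * (Real.exp 1 * normV (SpaceTimeIdx L M × SectorLeg N) κ ρ
              (fun m' => imagTimeWeight β M * hubbardSectorKernelNorm L M β F (univ : Finset (Fin (2 * m') → SectorLeg N)) G)) *
            (Real.exp 1 * α * normV (SpaceTimeIdx L M × SectorLeg N) κ ρ
                (fun m' => imagTimeWeight β M * hubbardSectorKernelNorm L M β F (univ : Finset (Fin (2 * m') → SectorLeg N)) G) /
              κ ^ 2) ^ (N₀ - 1) /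
            (1 - Real.exp 1 * α * normV (SpaceTimeIdx L M × SectorLeg N) κ ρ
                (fun m' => imagTimeWeight β M * hubbardSectorKernelNorm L M β F (univ : Finset (Fin (2 * m') → SectorLeg N)) G) /
              κ ^ 2)) := by
  set Nbar : ℕ → ℝ := fun m' => imagTimeWeight β M *
    hubbardSectorKernelNorm L M β F (univ : Finset (Fin (2 * m') → SectorLeg N)) G with hNbar
  set Nt : ℕ → ℝ := fun m' => kernelNorm 1 (2 * m') (kernel ℂ (sectorPreimage β F G) (2 * m')) with hNt
  have hle : ∀ m', Nt m' ≤ Nbar m' := fun m' => kernelNorm_kernel_sectorPreimage_two_mul_le hβ.le F G hG0 m'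
  have hNt0 : ∀ m', 0 ≤ Nt m' := fun m' => kernelNorm_nonneg zero_le_one _ _
  have hnV0 : 0 ≤ normV (SpaceTimeIdx L M × SectorLeg N) κ ρ Nt := normV_nonneg hκ.le hρ.le hNt0
  have hθ' : Real.exp 1 * α * normV (SpaceTimeIdx L M × SectorLeg N) κ ρ Nt / κ ^ 2 < 1 :=
    lt_of_le_of_lt (by gcongr; exact normV_mono hκ.le hρ.le hle) hθ
  -- norm of `G`-objects through `E(F′)` and transfer
  refine (hubbardSectorKernelNorm_le_kernelNorm_map hβ.le F' A _).trans ?_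
  have hea := map_sectorAnalysis_effAction_map_sectorPreimage_of_plateau hβ.ne' F Ft hFF hF0 F' G C hCpl hF'pl
  have hgc := map_sectorAnalysis_gaussConv_map_sectorPreimage_of_plateau hβ.ne' F Ft hFF hF0 F' G C hCpl hF'pl
  have hrepl : ExteriorAlgebra.map (Matrix.toLin' (sectorAnalysisMatrix L M β F')) (effAction ℂ C G - gaussConv ℂ C G) =
      ExteriorAlgebra.map (Matrix.toLin' (sectorAnalysisMatrix L M β F'))
        (effAction ℂ C (ExteriorAlgebra.map (Matrix.toLin' (sectorSubMatrix L M β Ft)) (sectorPreimage β F G)) -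
          gaussConv ℂ C (ExteriorAlgebra.map (Matrix.toLin' (sectorSubMatrix L M β Ft)) (sectorPreimage β F G))) := by
    rw [map_sub, map_sub, hea, hgc]
  rw [hrepl]
  have h := kernelNorm_kernel_map_effAction_sub_gaussConv_le_graded_of_gramBounded C (Matrix.toLin' (sectorSubMatrix L M β Ft))
    (Matrix.toLin' (sectorAnalysisMatrix L M β F')) (sectorPreimage β F G) (sectorPreimage_mem_evenPart β F hG)
    (by rw [constPart_sectorPreimage, hG0]) hκ (by simpa only [LinearMap.toMatrix'_toLin'] using hGB) hα
    (by simpa only [LinearMap.toMatrix'_toLin'] using hrow) (by simpa only [LinearMap.toMatrix'_toLin'] using hcol) hρ hθ' hcr0 hcc0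
    (by simpa only [LinearMap.toMatrix'_toLin'] using hrow') (by simpa only [LinearMap.toMatrix'_toLin'] using hcol')
    (imagTimeWeight_nonneg hβ.le M) hN₀ m
  refine h.trans (mul_le_mul_of_nonneg_left ?_
    (mul_nonneg (mul_nonneg hcr0 (pow_nonneg hcc0 _)) (pow_nonneg (imagTimeWeight_nonneg hβ.le M) _)))
  exact gradedIncrementBound_mono (SpaceTimeIdx L M × SectorLeg N) hκ hα.le hρ.le hNt0 hle hθ N₀ (m + 1)

end Transfer

end Literature.MathematicalPhysics.QuantumLattice

end
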